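import Literature.NumberTheory.Automorphic.Liu2021.Def411WeilCarriersAtLine
import Literature.NumberTheory.GelbartRogawski1991.ChiSplittingLocalFactors
import Literature.RepresentationTheory.TwistedCoinvariantsIrreducible
import HarnessLib

/-!
# [Liu2021, Def. 4.11]'s carrier `ω(μ, ε, χ)` AT THE `χ`-ATTACHED SPLITTING is the central `χ`-quotient of the place-assembled
# Weil representation of the local undoublings — an explicit, twist-free equivalence

Topic `NumberTheory/Automorphic/Liu2021`; namespace `Literature.NumberTheory.Automorphic.Liu2021.Def411WeilCarriers` (that of
`Def411WeilCarriersAtLine`).  KERNEL ONLY: theorems; no definition, no named fact, no `sorry`.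

The tree reads [Liu2021, Def. 4.11]'s `ω(μ, ε, χ)` at a representative line `⟨a⟩` as `rhoVAtLine … hs a χ`: the `U(J_V)(𝔸_{F,f})`-
representation on the `χ_W`-coinvariants of the finite Weil representation of the dual pair `U(J_V) × U(⟨a⟩)` through an ABSTRACT
compatible splitting family `s` (`Def411WeilCarriersAtLine`, ★).  For ANY such `s`, ★ `exists_weilCoinv_equiv_reference`
(`UnitaryDualPairWeilCoinvariantsReference`) identifies this quotient with the coinvariants of a reference section `s₀` UP TO A TWIST
CHARACTER `χtw` (`pairSmall₁ s ∘ finPairToAdelic = s₀ ⊗ χtw`, [GelbartRogawski1991, Remark p. 457]) — which is why the tree so far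
only transported IRREDUCIBILITY (`isIrreducible_weilCoinv_iff_omega_center`), never the representation itself.  For THE splitting
attached to a Hecke character `θ` by doubling — `Def411WeilCarriersDoubling.chiSplittingLine θ` ([HarrisKudlaSweet1996] `ι̃_{V,θ}`,
[Liu2021, App. D Step 2] `ι_μ`) — ★ `GRConstruction.pairSmall₁_chiSplittingLine_finPairToAdelic_eq_localRefSection`
(`ChiSplittingLocalFactors`) says the twist against the reference section of the local undoublings `𝓢_θ := congrW … (undoubledSplittings 𝓕)`
of ANY per-place package `𝓕` is TRIVIAL.  Hence, for THE splitting, the identification is an honest intertwiner: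

* `exists_equiv_rhoVAtLine_chiSplittingLine_omega_finPairEmb` — an explicit `T : ω(μ,ε,χ)|_{⟨a⟩} ≃ₗ Coinv(Ω ∘ (u ↦ reindex(1 ⊗ u)), χ_W)`
  with `T [f] = [R_e f]` and `T ∘ rhoVAtLine k = (k ↦ Ω(reindex (k ⊗ 1))) ∘ T`, `Ω = 𝓢_θ.Omega` the place-assembled Weil
  representation of the big group `U(J_V ⊗ ⟨a⟩)(𝔸_{F,f})`;
* `exists_equiv_rhoVAtLine_chiSplittingLine_omega_center` — the same with the `U(⟨a⟩)`-member replaced by the CENTRE `E¹(𝔸_{F,f})`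
  of the big group (`finPairEmb (1, u·1_W) = u·1_n`, ★ `finPairEmb_one_finAdelicCenter`; `χ_W ∘ (u ↦ u·1_W) = χ`, ★
  `lineChar_finAdelicCenter`): `ω(μ,ε,χ)|_{⟨a⟩} ≅` «the maximal quotient of `Ω` on which the centre acts by `χ`» ([Liu2021, App. D
  §D.1 Step 3]) with its `U(J_V)(𝔸_f)`-action — the representation whose `⊗'`-structure over the local central coinvariants
  `Coinv(ω_v ∘ (u ↦ u·1), χ_v)` is ★ `FinLocalSplittings.omegaPi_centralCoinv`;
* `rhoVAtLine_chiSplittingLine_areIsomorphicRep_omega_center` — the `AreIsomorphicRep` corollary.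

Consumer: the d6 line of cell `hodgecm-mathlib` (card S4c-2 «THE socket»: the registered `ω⋆ = rhoVAtLine … (hsChiGS θ …)` of
`thmD6OneCurveCUF`, whose `hsChiGS a` IS `isCompatible_chiSplittingLine θ … (T_W a) …`, read on the place-assembled side where
[Liu2021, Lem. D.1 (2)] is a LOCAL statement).  No mathematics beyond the ★ inputs; HC_CM is NOT proved by anything here.

## References
* [Liu2021] Y. Liu, *Fourier–Jacobi cycles and arithmetic relative trace formula*, Camb. J. Math. 9 (2021) = arXiv:2102.11518,
  Def. 4.11 (l. 2092–2096), App. D §D.1 Steps 1–3 (l. 5217–5221).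
* [GelbartRogawski1991] S. Gelbart, J. Rogawski, Invent. Math. 105 (1991), §3.1 Prop. 3.1.1 p. 455 L1–3, Remark p. 457 L4–13.
* [HarrisKudlaSweet1996] M. Harris, S. Kudla, W. J. Sweet, J. AMS 9 (1996), §1 (1.14)–(1.16), Cor. A.3.
-/

set_option autoImplicit false

noncomputable section

open scoped Matrix Kronecker TensorProduct Classical
open NumberField NumberField.mixedEmbedding IsDedekindDomain
open Literature.NumberTheory Literature.NumberTheory.Automorphic Literature.NumberTheory.Automorphic.UnitaryGroup
open Literature.NumberTheory.GelbartRogawski1991 Literature.NumberTheory.GelbartRogawski1991.UnitaryDualPair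
open Literature.NumberTheory.GelbartRogawski1991.UnitaryDualPair.WeilCoinv
open Literature.NumberTheory.GelbartRogawski1991.GRConstruction
open Literature.NumberTheory.Weil1964 Literature.RepresentationTheory
open Literature.RepresentationTheory.HeisenbergGroup
open Literature.NumberTheory.GaloisRepresentations Literature.RepresentationTheory.HarrisKudlaSweet1996
open Literature.NumberTheory.Automorphic.Liu2021.Def411WeilCarriersDoubling

namespace Literature.NumberTheory.Automorphic.Liu2021.Def411WeilCarriers

variable (L : Type) [Field L] [NumberField L] [IsCMField L]
variable {N' n' : ℕ} (e₁ : Fin N' × Fin 1 ≃ Fin n')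
  (dV₁ : Fin N' → L) (hdV₁ : ∀ i, IsCMField.complexConj L (dV₁ i) = dV₁ i) (hdV₁0 : ∀ i, dV₁ i ≠ 0)
  (θ : HeckeCharacter L) (hθu : θ.IsUnitary) (hθs : IsSplittingChar L 1 θ)
  (a : (Fp L)ˣ) (χ : Chi (Fp L) L (IsCMField.complexConj L))
  (𝔪 : ∀ v, PlaceMeasure L v)
  (𝓕 : FinLocalFamily L e₁ dV₁ hdV₁ hdV₁0 (lineW L (TW (Fp L) a)) (complexConj_lineW L (TW (Fp L) a))
    (lineW_ne_zero L (TW (Fp L) a) (isUnit_det_TW (Fp L) a)) θ 𝔪)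

/-- twisting a section by the trivial character changes nothing. [folklore] -/
private theorem twist_one_aux {F : Type} [Field F] [NumberField F] {ι : Type} [Fintype ι] [DecidableEq ι]
    {T : Matrix ι ι (AdeleRing (𝓞 F) F)} {H : Type*} [Group H] (s : H →* adelicMpCont F ι T) :
    adelicMpCont.twist F ι T s 1 = s :=
  MonoidHom.ext fun h => adelicMpCont.twist_eq_of_eq_one s 1 (MonoidHom.one_apply h)

include hdV₁0 in
set_option maxHeartbeats 1600000 in -- measured (800 k, 1.6 M]: the twist-free reference equivalence inside the pair telescope
/-- **`ω(μ,ε,χ)` AT THE `θ`-SPLITTING ≅ the `χ_W`-coinvariants of `Ω_θ ∘ (u ↦ reindex(1 ⊗ u))` with the action `k ↦ Ω_θ(reindex(k ⊗ 1))`,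
by an EXPLICIT twist-free intertwiner.**  Here `Ω_θ = 𝓢_θ.Omega` is the place-assembled Weil representation of the local undoublings
`𝓢_θ := congrW … (undoubledSplittings 𝓕)` of ANY per-place package `𝓕` of the doubled CM datum (its `v`-factor at a split place is
the undoubled split datum, ★ `ChiSplittingLocalFactors`); `T [f] = [R_e f]` (`R_e = finSBReindex`) and
`T (rhoVAtLine k x) = Ω_θ(reindex(k ⊗ 1)) · T x`.  Proof: ★ `exists_weilCoinv_equiv_reference` at `s₀ := localRefSection 𝓢_θ` with
the TRIVIAL twist (★ `pairSmall₁_chiSplittingLine_finPairToAdelic_eq_localRefSection`), then ★ `finRepMp_localRefSection_apply` along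
`TwistedCoinv.mapEquiv (finSBReindex …)`.
[cite: Liu2021, Def. 4.11 (l. 2092–2096), App. D §D.1 Steps 1–3 (l. 5217–5221)] [cite: GelbartRogawski1991, §3.1 Prop. 3.1.1 p. 455 L1–3, Remark p. 457 L4–13]
[cite: HarrisKudlaSweet1996, §1 (1.14)–(1.16), Cor. A.3] -/
theorem exists_equiv_rhoVAtLine_chiSplittingLine_omega_finPairEmb :
    ∃ T : omegaAtLine (Fp L) L (IsCMField.complexConj L) N' e₁ (Matrix.diagonal dV₁) (complexConj_imagUnit L)
          (imagUnit_ne_zero L) (imagUnit_mul_self L) (realDiagonal_isSymm L dV₁ hdV₁) (isUnit_det_realDiagonal L dV₁ hdV₁ hdV₁0)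
          (realDiagonal_map L dV₁ hdV₁).symm
          (fun b => isCompatible_chiSplittingLine L e₁ dV₁ hdV₁ hdV₁0 θ hθu hθs (TW (Fp L) b) (isSymm_TW (Fp L) b)
            (isUnit_det_TW (Fp L) b) (JW (Fp L) L b) (JW_eq (Fp L) L b)) a χ ≃ₗ[ℂ]
        TwistedCoinv.Coinv
          (show Representation ℂ (UnitaryGroup.finAdelic (Fp L) L (IsCMField.complexConj L) 1 (JW (Fp L) L a)) _ from
            (congrW L e₁ dV₁ hdV₁ (lineW L (TW (Fp L) a)) (complexConj_lineW L (TW (Fp L) a)) (realDiagonal_lineW L (TW (Fp L) a))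
                (diagonal_lineW L (TW (Fp L) a) (JW_eq (Fp L) L a))
                (undoubledSplittings L e₁ dV₁ hdV₁ hdV₁0 (lineW L (TW (Fp L) a)) (complexConj_lineW L (TW (Fp L) a))
                  (lineW_ne_zero L (TW (Fp L) a) (isUnit_det_TW (Fp L) a)) θ 𝔪 𝓕)
                (isSymm_TW (Fp L) a) (JW_eq (Fp L) L a)).Omega.comp
              ((finPairEmb (Fp L) L (IsCMField.complexConj L) N' 1 e₁ (Matrix.diagonal dV₁) (JW (Fp L) L a)).comp
                (MonoidHom.inr _ _)))
          (lineChar (Fp L) L (IsCMField.complexConj L) a χ.1),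
      (∀ f : FinSB (Fp L) (Fin N' × Fin 1),
        T (TwistedCoinv.mk
            (finPairRepW (Fp L) L (IsCMField.complexConj L) N' 1 e₁ (Matrix.diagonal dV₁) (JW (Fp L) L a)
              (complexConj_imagUnit L) (imagUnit_ne_zero L) (imagUnit_mul_self L) (realDiagonal_isSymm L dV₁ hdV₁)
              (isSymm_TW (Fp L) a) (isUnit_det_realDiagonal L dV₁ hdV₁ hdV₁0) (isUnit_det_TW (Fp L) a)
              (realDiagonal_map L dV₁ hdV₁).symm (JW_eq (Fp L) L a)
              (isCompatible_chiSplittingLine L e₁ dV₁ hdV₁ hdV₁0 θ hθu hθs (TW (Fp L) a) (isSymm_TW (Fp L) a)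
                (isUnit_det_TW (Fp L) a) (JW (Fp L) L a) (JW_eq (Fp L) L a)))
            (lineChar (Fp L) L (IsCMField.complexConj L) a χ.1) f) =
          TwistedCoinv.mk _ (lineChar (Fp L) L (IsCMField.complexConj L) a χ.1) (finSBReindex (Fp L) e₁ f)) ∧
      ∀ (k : UnitaryGroup.finAdelic (Fp L) L (IsCMField.complexConj L) N' (Matrix.diagonal dV₁))
        (x : omegaAtLine (Fp L) L (IsCMField.complexConj L) N' e₁ (Matrix.diagonal dV₁) (complexConj_imagUnit L)
          (imagUnit_ne_zero L) (imagUnit_mul_self L) (realDiagonal_isSymm L dV₁ hdV₁) (isUnit_det_realDiagonal L dV₁ hdV₁ hdV₁0)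
          (realDiagonal_map L dV₁ hdV₁).symm
          (fun b => isCompatible_chiSplittingLine L e₁ dV₁ hdV₁ hdV₁0 θ hθu hθs (TW (Fp L) b) (isSymm_TW (Fp L) b)
            (isUnit_det_TW (Fp L) b) (JW (Fp L) L b) (JW_eq (Fp L) L b)) a χ),
        T (rhoVAtLine (Fp L) L (IsCMField.complexConj L) N' e₁ (Matrix.diagonal dV₁) (complexConj_imagUnit L)
            (imagUnit_ne_zero L) (imagUnit_mul_self L) (realDiagonal_isSymm L dV₁ hdV₁) (isUnit_det_realDiagonal L dV₁ hdV₁ hdV₁0)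
            (realDiagonal_map L dV₁ hdV₁).symm
            (fun b => isCompatible_chiSplittingLine L e₁ dV₁ hdV₁ hdV₁0 θ hθu hθs (TW (Fp L) b) (isSymm_TW (Fp L) b)
              (isUnit_det_TW (Fp L) b) (JW (Fp L) L b) (JW_eq (Fp L) L b)) a χ k x) =
          TwistedCoinv.rep (lineChar (Fp L) L (IsCMField.complexConj L) a χ.1)
            (show Representation ℂ (UnitaryGroup.finAdelic (Fp L) L (IsCMField.complexConj L) N' (Matrix.diagonal dV₁)) _ from
              (congrW L e₁ dV₁ hdV₁ (lineW L (TW (Fp L) a)) (complexConj_lineW L (TW (Fp L) a)) (realDiagonal_lineW L (TW (Fp L) a))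
                  (diagonal_lineW L (TW (Fp L) a) (JW_eq (Fp L) L a))
                  (undoubledSplittings L e₁ dV₁ hdV₁ hdV₁0 (lineW L (TW (Fp L) a)) (complexConj_lineW L (TW (Fp L) a))
                    (lineW_ne_zero L (TW (Fp L) a) (isUnit_det_TW (Fp L) a)) θ 𝔪 𝓕)
                  (isSymm_TW (Fp L) a) (JW_eq (Fp L) L a)).Omega.comp
                ((finPairEmb (Fp L) L (IsCMField.complexConj L) N' 1 e₁ (Matrix.diagonal dV₁) (JW (Fp L) L a)).comp
                  (MonoidHom.inl _ _)))
            (commute_omega_finPairEmb (Fp L) L (IsCMField.complexConj L) N' 1 e₁ (Matrix.diagonal dV₁) (JW (Fp L) L a)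
              (complexConj_imagUnit L) (imagUnit_ne_zero L) (imagUnit_mul_self L) (realDiagonal_isSymm L dV₁ hdV₁)
              (isSymm_TW (Fp L) a) (realDiagonal_map L dV₁ hdV₁).symm (JW_eq (Fp L) L a) _)
            k (T x) := by
  -- abbreviations
  set 𝓢 := congrW L e₁ dV₁ hdV₁ (lineW L (TW (Fp L) a)) (complexConj_lineW L (TW (Fp L) a)) (realDiagonal_lineW L (TW (Fp L) a))
      (diagonal_lineW L (TW (Fp L) a) (JW_eq (Fp L) L a))
      (undoubledSplittings L e₁ dV₁ hdV₁ hdV₁0 (lineW L (TW (Fp L) a)) (complexConj_lineW L (TW (Fp L) a))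
        (lineW_ne_zero L (TW (Fp L) a) (isUnit_det_TW (Fp L) a)) θ 𝔪 𝓕)
      (isSymm_TW (Fp L) a) (JW_eq (Fp L) L a) with h𝓢
  have hs := isCompatible_chiSplittingLine L e₁ dV₁ hdV₁ hdV₁0 θ hθu hθs (TW (Fp L) a) (isSymm_TW (Fp L) a)
    (isUnit_det_TW (Fp L) a) (JW (Fp L) L a) (JW_eq (Fp L) L a)
  -- the twist against the reference section of the local undoublings is TRIVIAL (★ `ChiSplittingLocalFactors`)
  have hχtw : (pairSmall₁ (Fp L) L (IsCMField.complexConj L) N' 1 e₁ (Matrix.diagonal dV₁) (JW (Fp L) L a)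
        (chiSplittingLine L e₁ dV₁ hdV₁ hdV₁0 θ hθu hθs (TW (Fp L) a) (isUnit_det_TW (Fp L) a) (JW (Fp L) L a)
          (JW_eq (Fp L) L a))).comp
      (finPairToAdelic (Fp L) L (IsCMField.complexConj L) N' 1 (Matrix.diagonal dV₁) (JW (Fp L) L a)) =
      adelicMpCont.twist (Fp L) (Fin N' × Fin 1) _
        (localRefSection (Fp L) L (IsCMField.complexConj L) N' 1 e₁ (Matrix.diagonal dV₁) (JW (Fp L) L a)
          (complexConj_imagUnit L) (imagUnit_ne_zero L) (imagUnit_mul_self L) (realDiagonal_isSymm L dV₁ hdV₁)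
          (isSymm_TW (Fp L) a) (realDiagonal_map L dV₁ hdV₁).symm (JW_eq (Fp L) L a) 𝓢) 1 := by
    rw [twist_one_aux, h𝓢]
    exact pairSmall₁_chiSplittingLine_finPairToAdelic_eq_localRefSection L θ hθu hθs e₁ dV₁ hdV₁ hdV₁0 (TW (Fp L) a)
      (isSymm_TW (Fp L) a) (isUnit_det_TW (Fp L) a) (JW (Fp L) L a) (JW_eq (Fp L) L a) 𝔪 𝓕
  have hχ' : ∀ u, lineChar (Fp L) L (IsCMField.complexConj L) a χ.1 u =
      (1 : UnitaryGroup.finAdelic (Fp L) L (IsCMField.complexConj L) N' (Matrix.diagonal dV₁) ×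
          UnitaryGroup.finAdelic (Fp L) L (IsCMField.complexConj L) 1 (JW (Fp L) L a) →* ℂˣ) (1, u) *
        lineChar (Fp L) L (IsCMField.complexConj L) a χ.1 u := fun u => by
    rw [MonoidHom.one_apply, one_mul]
  -- ★ the reference equivalence, twist-free
  have hT₀ := exists_weilCoinv_equiv_reference (Fp L) L (IsCMField.complexConj L) N' 1 e₁ (Matrix.diagonal dV₁) (JW (Fp L) L a)
    (complexConj_imagUnit L) (imagUnit_ne_zero L) (imagUnit_mul_self L) (realDiagonal_isSymm L dV₁ hdV₁) (isSymm_TW (Fp L) a)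
    (isUnit_det_realDiagonal L dV₁ hdV₁ hdV₁0) (isUnit_det_TW (Fp L) a) (realDiagonal_map L dV₁ hdV₁).symm (JW_eq (Fp L) L a)
    (proj_localRefSection_eq (Fp L) L (IsCMField.complexConj L) N' 1 e₁ (Matrix.diagonal dV₁) (JW (Fp L) L a)
      (complexConj_imagUnit L) (imagUnit_ne_zero L) (imagUnit_mul_self L) (realDiagonal_isSymm L dV₁ hdV₁) (isSymm_TW (Fp L) a)
      (isUnit_det_realDiagonal L dV₁ hdV₁ hdV₁0) (isUnit_det_TW (Fp L) a) (realDiagonal_map L dV₁ hdV₁).symm (JW_eq (Fp L) L a)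
      𝓢 hs)
    hχtw hs hχ'
  obtain ⟨T₀, hT₀mk, hT₀rep⟩ := hT₀
  -- ★ `finRepMp s₀ = R_e⁻¹ Ω(finPairEmb ·) R_e`: transport along `R_e = finSBReindex`
  have key : ∀ (p : UnitaryGroup.finAdelic (Fp L) L (IsCMField.complexConj L) N' (Matrix.diagonal dV₁) ×
        UnitaryGroup.finAdelic (Fp L) L (IsCMField.complexConj L) 1 (JW (Fp L) L a)) (f : FinSB (Fp L) (Fin N' × Fin 1)),
      𝓢.Omega (finPairEmb (Fp L) L (IsCMField.complexConj L) N' 1 e₁ (Matrix.diagonal dV₁) (JW (Fp L) L a) p)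
          (finSBReindex (Fp L) e₁ f) =
        finSBReindex (Fp L) e₁
          (finRepMp (isUnit_kronecker_map (Fp L) N' (isUnit_det_realDiagonal L dV₁ hdV₁ hdV₁0) (isUnit_det_TW (Fp L) a))
            (localRefSection (Fp L) L (IsCMField.complexConj L) N' 1 e₁ (Matrix.diagonal dV₁) (JW (Fp L) L a)
              (complexConj_imagUnit L) (imagUnit_ne_zero L) (imagUnit_mul_self L) (realDiagonal_isSymm L dV₁ hdV₁)
              (isSymm_TW (Fp L) a) (realDiagonal_map L dV₁ hdV₁).symm (JW_eq (Fp L) L a) 𝓢)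
            (harch_localRefSection (Fp L) L (IsCMField.complexConj L) N' 1 e₁ (Matrix.diagonal dV₁) (JW (Fp L) L a)
              (complexConj_imagUnit L) (imagUnit_ne_zero L) (imagUnit_mul_self L) (realDiagonal_isSymm L dV₁ hdV₁)
              (isSymm_TW (Fp L) a) (isUnit_det_realDiagonal L dV₁ hdV₁ hdV₁0) (isUnit_det_TW (Fp L) a)
              (realDiagonal_map L dV₁ hdV₁).symm (JW_eq (Fp L) L a) 𝓢 hs) p f) := by
    intro p f
    rw [finRepMp_localRefSection_apply (Fp L) L (IsCMField.complexConj L) N' 1 e₁ (Matrix.diagonal dV₁) (JW (Fp L) L a)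
      (complexConj_imagUnit L) (imagUnit_ne_zero L) (imagUnit_mul_self L) (realDiagonal_isSymm L dV₁ hdV₁) (isSymm_TW (Fp L) a)
      (isUnit_det_realDiagonal L dV₁ hdV₁ hdV₁0) (isUnit_det_TW (Fp L) a) (realDiagonal_map L dV₁ hdV₁).symm (JW_eq (Fp L) L a)
      𝓢 hs, LinearEquiv.apply_symm_apply]
  let T₁ := TwistedCoinv.mapEquiv
    ((finRepMp (isUnit_kronecker_map (Fp L) N' (isUnit_det_realDiagonal L dV₁ hdV₁ hdV₁0) (isUnit_det_TW (Fp L) a))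
        (localRefSection (Fp L) L (IsCMField.complexConj L) N' 1 e₁ (Matrix.diagonal dV₁) (JW (Fp L) L a)
          (complexConj_imagUnit L) (imagUnit_ne_zero L) (imagUnit_mul_self L) (realDiagonal_isSymm L dV₁ hdV₁)
          (isSymm_TW (Fp L) a) (realDiagonal_map L dV₁ hdV₁).symm (JW_eq (Fp L) L a) 𝓢)
        (harch_localRefSection (Fp L) L (IsCMField.complexConj L) N' 1 e₁ (Matrix.diagonal dV₁) (JW (Fp L) L a)
          (complexConj_imagUnit L) (imagUnit_ne_zero L) (imagUnit_mul_self L) (realDiagonal_isSymm L dV₁ hdV₁)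
          (isSymm_TW (Fp L) a) (isUnit_det_realDiagonal L dV₁ hdV₁ hdV₁0) (isUnit_det_TW (Fp L) a)
          (realDiagonal_map L dV₁ hdV₁).symm (JW_eq (Fp L) L a) 𝓢 hs)).comp (MonoidHom.inr _ _))
    (lineChar (Fp L) L (IsCMField.complexConj L) a χ.1)
    (show Representation ℂ (UnitaryGroup.finAdelic (Fp L) L (IsCMField.complexConj L) 1 (JW (Fp L) L a)) _ from
      𝓢.Omega.comp ((finPairEmb (Fp L) L (IsCMField.complexConj L) N' 1 e₁ (Matrix.diagonal dV₁) (JW (Fp L) L a)).comp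
        (MonoidHom.inr _ _)))
    (lineChar (Fp L) L (IsCMField.complexConj L) a χ.1)
    (finSBReindex (Fp L) e₁) (fun _ => 1)
    (fun u f => by rw [Units.val_one, one_smul]; exact key (1, u) f)
    (fun u => (one_mul _).symm)
  refine ⟨T₀.trans T₁, fun f => ?_, fun k x => ?_⟩
  · rw [LinearEquiv.trans_apply, hT₀mk, TwistedCoinv.mapEquiv_mk]
  · rw [LinearEquiv.trans_apply, LinearEquiv.trans_apply]
    unfold rhoVAtLine
    rw [hT₀rep, MonoidHom.one_apply, Units.val_one, one_smul]
    have h := TwistedCoinv.mapEquiv_rep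
      ((finRepMp (isUnit_kronecker_map (Fp L) N' (isUnit_det_realDiagonal L dV₁ hdV₁ hdV₁0) (isUnit_det_TW (Fp L) a))
          (localRefSection (Fp L) L (IsCMField.complexConj L) N' 1 e₁ (Matrix.diagonal dV₁) (JW (Fp L) L a)
            (complexConj_imagUnit L) (imagUnit_ne_zero L) (imagUnit_mul_self L) (realDiagonal_isSymm L dV₁ hdV₁)
            (isSymm_TW (Fp L) a) (realDiagonal_map L dV₁ hdV₁).symm (JW_eq (Fp L) L a) 𝓢)
          (harch_localRefSection (Fp L) L (IsCMField.complexConj L) N' 1 e₁ (Matrix.diagonal dV₁) (JW (Fp L) L a)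
            (complexConj_imagUnit L) (imagUnit_ne_zero L) (imagUnit_mul_self L) (realDiagonal_isSymm L dV₁ hdV₁)
            (isSymm_TW (Fp L) a) (isUnit_det_realDiagonal L dV₁ hdV₁ hdV₁0) (isUnit_det_TW (Fp L) a)
            (realDiagonal_map L dV₁ hdV₁).symm (JW_eq (Fp L) L a) 𝓢 hs)).comp (MonoidHom.inr _ _))
      (lineChar (Fp L) L (IsCMField.complexConj L) a χ.1)
      (show Representation ℂ (UnitaryGroup.finAdelic (Fp L) L (IsCMField.complexConj L) 1 (JW (Fp L) L a)) _ from
        𝓢.Omega.comp ((finPairEmb (Fp L) L (IsCMField.complexConj L) N' 1 e₁ (Matrix.diagonal dV₁) (JW (Fp L) L a)).comp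
          (MonoidHom.inr _ _)))
      (lineChar (Fp L) L (IsCMField.complexConj L) a χ.1)
      ((finRepMp (isUnit_kronecker_map (Fp L) N' (isUnit_det_realDiagonal L dV₁ hdV₁ hdV₁0) (isUnit_det_TW (Fp L) a))
          (localRefSection (Fp L) L (IsCMField.complexConj L) N' 1 e₁ (Matrix.diagonal dV₁) (JW (Fp L) L a)
            (complexConj_imagUnit L) (imagUnit_ne_zero L) (imagUnit_mul_self L) (realDiagonal_isSymm L dV₁ hdV₁)
            (isSymm_TW (Fp L) a) (realDiagonal_map L dV₁ hdV₁).symm (JW_eq (Fp L) L a) 𝓢)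
          (harch_localRefSection (Fp L) L (IsCMField.complexConj L) N' 1 e₁ (Matrix.diagonal dV₁) (JW (Fp L) L a)
            (complexConj_imagUnit L) (imagUnit_ne_zero L) (imagUnit_mul_self L) (realDiagonal_isSymm L dV₁ hdV₁)
            (isSymm_TW (Fp L) a) (isUnit_det_realDiagonal L dV₁ hdV₁ hdV₁0) (isUnit_det_TW (Fp L) a)
            (realDiagonal_map L dV₁ hdV₁).symm (JW_eq (Fp L) L a) 𝓢 hs)).comp (MonoidHom.inl _ _))
      (show Representation ℂ (UnitaryGroup.finAdelic (Fp L) L (IsCMField.complexConj L) N' (Matrix.diagonal dV₁)) _ from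
        𝓢.Omega.comp ((finPairEmb (Fp L) L (IsCMField.complexConj L) N' 1 e₁ (Matrix.diagonal dV₁) (JW (Fp L) L a)).comp
          (MonoidHom.inl _ _)))
      (commute_comp_inl_comp_inr _)
      (commute_omega_finPairEmb (Fp L) L (IsCMField.complexConj L) N' 1 e₁ (Matrix.diagonal dV₁) (JW (Fp L) L a)
        (complexConj_imagUnit L) (imagUnit_ne_zero L) (imagUnit_mul_self L) (realDiagonal_isSymm L dV₁ hdV₁)
        (isSymm_TW (Fp L) a) (realDiagonal_map L dV₁ hdV₁).symm (JW_eq (Fp L) L a) 𝓢)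
      (finSBReindex (Fp L) e₁) (fun _ => 1)
      (fun u f => by rw [Units.val_one, one_smul]; exact key (1, u) f)
      (fun u => (one_mul _).symm) (g := k) (g' := k) (a := (1 : ℂ))
      (fun f => by rw [one_smul]; exact key (k, 1) f) (T₀ x)
    rw [one_smul] at h
    exact h.symm


include hdV₁0 in
set_option maxHeartbeats 800000 in -- measured (400 k, 800 k]: the centre identification inside the pair telescope
/-- **`ω(μ,ε,χ)` AT THE `θ`-SPLITTING ≅ «the maximal quotient of `Ω_θ` on which the CENTRE `E¹(𝔸_{F,f})` acts by `χ`» with its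
`U(J_V)(𝔸_{F,f})`-action `k ↦ Ω_θ(reindex(k ⊗ 1))`** ([Liu2021, App. D §D.1 Step 3] on the place-assembled carrier): an explicit
`T' : ω(μ,ε,χ)|_{⟨a⟩} ≃ₗ Coinv(Ω_θ ∘ (u ↦ u·1_n), χ)` with `T' [f] = [R_e f]` and `T' ∘ rhoVAtLine k = Ω_θ(reindex(k ⊗ 1)) ∘ T'`.
From `exists_equiv_rhoVAtLine_chiSplittingLine_omega_finPairEmb`: the `U(⟨a⟩)`-member of the pair IS the centre
(★ `finPairEmb_one_finAdelicCenter`, `finAdelicCenter_surjective_one`, `TwistedCoinv.ker_comp_of_surjective`) and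
`χ_W ∘ (u ↦ u·1_W) = χ` (★ `lineChar_finAdelicCenter`).  This is the representation whose `⊗'`-decomposition over the LOCAL central
coinvariants is ★ `FinLocalSplittings.omegaPi_centralCoinv` (read through `Ω = Ω_Π ∘ finAdelicEquiv`).
[cite: Liu2021, Def. 4.11 (l. 2092–2096), App. D §D.1 Step 3 (l. 5221)] [cite: GelbartRogawski1991, §3.1 Prop. 3.1.1 p. 455 L1–3, Remark p. 457 L4–13] -/
theorem exists_equiv_rhoVAtLine_chiSplittingLine_omega_center :
    ∃ T : omegaAtLine (Fp L) L (IsCMField.complexConj L) N' e₁ (Matrix.diagonal dV₁) (complexConj_imagUnit L)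
          (imagUnit_ne_zero L) (imagUnit_mul_self L) (realDiagonal_isSymm L dV₁ hdV₁) (isUnit_det_realDiagonal L dV₁ hdV₁ hdV₁0)
          (realDiagonal_map L dV₁ hdV₁).symm
          (fun b => isCompatible_chiSplittingLine L e₁ dV₁ hdV₁ hdV₁0 θ hθu hθs (TW (Fp L) b) (isSymm_TW (Fp L) b)
            (isUnit_det_TW (Fp L) b) (JW (Fp L) L b) (JW_eq (Fp L) L b)) a χ ≃ₗ[ℂ]
        TwistedCoinv.Coinv
          (show Representation ℂ (UnitaryGroup.finAdelicOne (Fp L) L (IsCMField.complexConj L)) _ from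
            (congrW L e₁ dV₁ hdV₁ (lineW L (TW (Fp L) a)) (complexConj_lineW L (TW (Fp L) a)) (realDiagonal_lineW L (TW (Fp L) a))
                (diagonal_lineW L (TW (Fp L) a) (JW_eq (Fp L) L a))
                (undoubledSplittings L e₁ dV₁ hdV₁ hdV₁0 (lineW L (TW (Fp L) a)) (complexConj_lineW L (TW (Fp L) a))
                  (lineW_ne_zero L (TW (Fp L) a) (isUnit_det_TW (Fp L) a)) θ 𝔪 𝓕)
                (isSymm_TW (Fp L) a) (JW_eq (Fp L) L a)).Omega.comp
              (UnitaryGroup.finAdelicCenter (Fp L) L (IsCMField.complexConj L) n'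
                (Matrix.reindex e₁ e₁ (Matrix.diagonal dV₁ ⊗ₖ JW (Fp L) L a))))
          χ.1,
      (∀ f : FinSB (Fp L) (Fin N' × Fin 1),
        T (TwistedCoinv.mk
            (finPairRepW (Fp L) L (IsCMField.complexConj L) N' 1 e₁ (Matrix.diagonal dV₁) (JW (Fp L) L a)
              (complexConj_imagUnit L) (imagUnit_ne_zero L) (imagUnit_mul_self L) (realDiagonal_isSymm L dV₁ hdV₁)
              (isSymm_TW (Fp L) a) (isUnit_det_realDiagonal L dV₁ hdV₁ hdV₁0) (isUnit_det_TW (Fp L) a)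
              (realDiagonal_map L dV₁ hdV₁).symm (JW_eq (Fp L) L a)
              (isCompatible_chiSplittingLine L e₁ dV₁ hdV₁ hdV₁0 θ hθu hθs (TW (Fp L) a) (isSymm_TW (Fp L) a)
                (isUnit_det_TW (Fp L) a) (JW (Fp L) L a) (JW_eq (Fp L) L a)))
            (lineChar (Fp L) L (IsCMField.complexConj L) a χ.1) f) =
          TwistedCoinv.mk _ χ.1 (finSBReindex (Fp L) e₁ f)) ∧
      ∀ (k : UnitaryGroup.finAdelic (Fp L) L (IsCMField.complexConj L) N' (Matrix.diagonal dV₁))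
        (x : omegaAtLine (Fp L) L (IsCMField.complexConj L) N' e₁ (Matrix.diagonal dV₁) (complexConj_imagUnit L)
          (imagUnit_ne_zero L) (imagUnit_mul_self L) (realDiagonal_isSymm L dV₁ hdV₁) (isUnit_det_realDiagonal L dV₁ hdV₁ hdV₁0)
          (realDiagonal_map L dV₁ hdV₁).symm
          (fun b => isCompatible_chiSplittingLine L e₁ dV₁ hdV₁ hdV₁0 θ hθu hθs (TW (Fp L) b) (isSymm_TW (Fp L) b)
            (isUnit_det_TW (Fp L) b) (JW (Fp L) L b) (JW_eq (Fp L) L b)) a χ),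
        T (rhoVAtLine (Fp L) L (IsCMField.complexConj L) N' e₁ (Matrix.diagonal dV₁) (complexConj_imagUnit L)
            (imagUnit_ne_zero L) (imagUnit_mul_self L) (realDiagonal_isSymm L dV₁ hdV₁) (isUnit_det_realDiagonal L dV₁ hdV₁ hdV₁0)
            (realDiagonal_map L dV₁ hdV₁).symm
            (fun b => isCompatible_chiSplittingLine L e₁ dV₁ hdV₁ hdV₁0 θ hθu hθs (TW (Fp L) b) (isSymm_TW (Fp L) b)
              (isUnit_det_TW (Fp L) b) (JW (Fp L) L b) (JW_eq (Fp L) L b)) a χ k x) =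
          TwistedCoinv.rep χ.1
            (show Representation ℂ (UnitaryGroup.finAdelic (Fp L) L (IsCMField.complexConj L) N' (Matrix.diagonal dV₁)) _ from
              (congrW L e₁ dV₁ hdV₁ (lineW L (TW (Fp L) a)) (complexConj_lineW L (TW (Fp L) a)) (realDiagonal_lineW L (TW (Fp L) a))
                  (diagonal_lineW L (TW (Fp L) a) (JW_eq (Fp L) L a))
                  (undoubledSplittings L e₁ dV₁ hdV₁ hdV₁0 (lineW L (TW (Fp L) a)) (complexConj_lineW L (TW (Fp L) a))
                    (lineW_ne_zero L (TW (Fp L) a) (isUnit_det_TW (Fp L) a)) θ 𝔪 𝓕)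
                  (isSymm_TW (Fp L) a) (JW_eq (Fp L) L a)).Omega.comp
                ((finPairEmb (Fp L) L (IsCMField.complexConj L) N' 1 e₁ (Matrix.diagonal dV₁) (JW (Fp L) L a)).comp
                  (MonoidHom.inl _ _)))
            (commute_omega_finPairEmb_finAdelicCenter (Fp L) L (IsCMField.complexConj L) N' e₁ (Matrix.diagonal dV₁)
              (JW (Fp L) L a) (complexConj_imagUnit L) (imagUnit_ne_zero L) (imagUnit_mul_self L) (realDiagonal_isSymm L dV₁ hdV₁)
              (isSymm_TW (Fp L) a) (realDiagonal_map L dV₁ hdV₁).symm (JW_eq (Fp L) L a) _)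
            k (T x) := by
  set 𝓢 := congrW L e₁ dV₁ hdV₁ (lineW L (TW (Fp L) a)) (complexConj_lineW L (TW (Fp L) a)) (realDiagonal_lineW L (TW (Fp L) a))
      (diagonal_lineW L (TW (Fp L) a) (JW_eq (Fp L) L a))
      (undoubledSplittings L e₁ dV₁ hdV₁ hdV₁0 (lineW L (TW (Fp L) a)) (complexConj_lineW L (TW (Fp L) a))
        (lineW_ne_zero L (TW (Fp L) a) (isUnit_det_TW (Fp L) a)) θ 𝔪 𝓕)
      (isSymm_TW (Fp L) a) (JW_eq (Fp L) L a) with h𝓢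
  have hT := exists_equiv_rhoVAtLine_chiSplittingLine_omega_finPairEmb L e₁ dV₁ hdV₁ hdV₁0 θ hθu hθs a χ 𝔪 𝓕
  rw [← h𝓢] at hT
  obtain ⟨T, hTmk, hTrep⟩ := hT
  -- the `U(⟨a⟩)`-member of the pair IS the centre: `Ω(reindex(1 ⊗ u·1_W)) = Ω(u·1_n)`
  have hWrep : (show Representation ℂ (UnitaryGroup.finAdelicOne (Fp L) L (IsCMField.complexConj L)) _ from
      (show Representation ℂ (UnitaryGroup.finAdelic (Fp L) L (IsCMField.complexConj L) 1 (JW (Fp L) L a)) _ from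
        𝓢.Omega.comp ((finPairEmb (Fp L) L (IsCMField.complexConj L) N' 1 e₁ (Matrix.diagonal dV₁) (JW (Fp L) L a)).comp
          (MonoidHom.inr _ _))).comp
        (UnitaryGroup.finAdelicCenter (Fp L) L (IsCMField.complexConj L) 1 (JW (Fp L) L a))) =
      (show Representation ℂ (UnitaryGroup.finAdelicOne (Fp L) L (IsCMField.complexConj L)) _ from
        𝓢.Omega.comp (UnitaryGroup.finAdelicCenter (Fp L) L (IsCMField.complexConj L) n'
          (Matrix.reindex e₁ e₁ (Matrix.diagonal dV₁ ⊗ₖ JW (Fp L) L a)))) := by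
    refine MonoidHom.ext fun u => ?_
    change 𝓢.Omega (finPairEmb (Fp L) L (IsCMField.complexConj L) N' 1 e₁ (Matrix.diagonal dV₁) (JW (Fp L) L a)
        (1, UnitaryGroup.finAdelicCenter (Fp L) L (IsCMField.complexConj L) 1 (JW (Fp L) L a) u)) =
      𝓢.Omega (UnitaryGroup.finAdelicCenter (Fp L) L (IsCMField.complexConj L) n'
        (Matrix.reindex e₁ e₁ (Matrix.diagonal dV₁ ⊗ₖ JW (Fp L) L a)) u)
    rw [finPairEmb_one_finAdelicCenter]
  -- `χ_W ∘ (u ↦ u·1_W) = χ`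
  have hχc : (lineChar (Fp L) L (IsCMField.complexConj L) a χ.1).comp
      (UnitaryGroup.finAdelicCenter (Fp L) L (IsCMField.complexConj L) 1 (JW (Fp L) L a)) = χ.1 :=
    MonoidHom.ext fun u => lineChar_finAdelicCenter (Fp L) L (IsCMField.complexConj L) a χ.1 u
  -- the two coinvariant spaces are the quotients by the SAME submodule
  have hker : TwistedCoinv.ker
      (show Representation ℂ (UnitaryGroup.finAdelic (Fp L) L (IsCMField.complexConj L) 1 (JW (Fp L) L a)) _ from
        𝓢.Omega.comp ((finPairEmb (Fp L) L (IsCMField.complexConj L) N' 1 e₁ (Matrix.diagonal dV₁) (JW (Fp L) L a)).comp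
          (MonoidHom.inr _ _)))
      (lineChar (Fp L) L (IsCMField.complexConj L) a χ.1) =
      TwistedCoinv.ker
        (show Representation ℂ (UnitaryGroup.finAdelicOne (Fp L) L (IsCMField.complexConj L)) _ from
          𝓢.Omega.comp (UnitaryGroup.finAdelicCenter (Fp L) L (IsCMField.complexConj L) n'
            (Matrix.reindex e₁ e₁ (Matrix.diagonal dV₁ ⊗ₖ JW (Fp L) L a))))
        χ.1 := by
    rw [← TwistedCoinv.ker_comp_of_surjective _ (lineChar (Fp L) L (IsCMField.complexConj L) a χ.1)
      (UnitaryGroup.finAdelicCenter (Fp L) L (IsCMField.complexConj L) 1 (JW (Fp L) L a))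
      (UnitaryGroup.finAdelicCenter_surjective_one (Fp L) L (IsCMField.complexConj L) (JW (Fp L) L a)
        (JW_apply_ne_zero (Fp L) L a)), hχc]
    exact congrArg (fun ρ => TwistedCoinv.ker ρ χ.1) hWrep
  refine ⟨T.trans (Submodule.quotEquivOfEq _ _ hker), fun f => ?_, fun k x => ?_⟩
  · rw [LinearEquiv.trans_apply, hTmk]
    rfl
  · rw [LinearEquiv.trans_apply, LinearEquiv.trans_apply, hTrep]
    obtain ⟨v, hv⟩ := TwistedCoinv.mk_surjective _ (lineChar (Fp L) L (IsCMField.complexConj L) a χ.1) (T x)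
    rw [← hv]
    rfl

include hdV₁0 in
set_option maxHeartbeats 800000 in -- measured (400 k, 800 k]: statement elaboration of the pair telescope
/-- **`AreIsomorphicRep` corollary**: `ω(μ,ε,χ)|_{⟨a⟩}` at the `θ`-splitting and the `U(J_V)(𝔸_f)`-action on the central `χ`-quotient of
`Ω_θ` are isomorphic representations. [cite: Liu2021, Def. 4.11 (l. 2092–2096), App. D §D.1 Step 3 (l. 5221)]
[cite: GelbartRogawski1991, §3.1 Remark p. 457 L4–13] -/
theorem rhoVAtLine_chiSplittingLine_areIsomorphicRep_omega_center :
    AreIsomorphicRep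
      (rhoVAtLine (Fp L) L (IsCMField.complexConj L) N' e₁ (Matrix.diagonal dV₁) (complexConj_imagUnit L)
        (imagUnit_ne_zero L) (imagUnit_mul_self L) (realDiagonal_isSymm L dV₁ hdV₁) (isUnit_det_realDiagonal L dV₁ hdV₁ hdV₁0)
        (realDiagonal_map L dV₁ hdV₁).symm
        (fun b => isCompatible_chiSplittingLine L e₁ dV₁ hdV₁ hdV₁0 θ hθu hθs (TW (Fp L) b) (isSymm_TW (Fp L) b)
          (isUnit_det_TW (Fp L) b) (JW (Fp L) L b) (JW_eq (Fp L) L b)) a χ)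
      (TwistedCoinv.rep χ.1
        (show Representation ℂ (UnitaryGroup.finAdelic (Fp L) L (IsCMField.complexConj L) N' (Matrix.diagonal dV₁)) _ from
          (congrW L e₁ dV₁ hdV₁ (lineW L (TW (Fp L) a)) (complexConj_lineW L (TW (Fp L) a)) (realDiagonal_lineW L (TW (Fp L) a))
              (diagonal_lineW L (TW (Fp L) a) (JW_eq (Fp L) L a))
              (undoubledSplittings L e₁ dV₁ hdV₁ hdV₁0 (lineW L (TW (Fp L) a)) (complexConj_lineW L (TW (Fp L) a))
                (lineW_ne_zero L (TW (Fp L) a) (isUnit_det_TW (Fp L) a)) θ 𝔪 𝓕)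
              (isSymm_TW (Fp L) a) (JW_eq (Fp L) L a)).Omega.comp
            ((finPairEmb (Fp L) L (IsCMField.complexConj L) N' 1 e₁ (Matrix.diagonal dV₁) (JW (Fp L) L a)).comp
              (MonoidHom.inl _ _)))
        (commute_omega_finPairEmb_finAdelicCenter (Fp L) L (IsCMField.complexConj L) N' e₁ (Matrix.diagonal dV₁)
          (JW (Fp L) L a) (complexConj_imagUnit L) (imagUnit_ne_zero L) (imagUnit_mul_self L) (realDiagonal_isSymm L dV₁ hdV₁)
          (isSymm_TW (Fp L) a) (realDiagonal_map L dV₁ hdV₁).symm (JW_eq (Fp L) L a) _)) := by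
  obtain ⟨T, -, hT⟩ := exists_equiv_rhoVAtLine_chiSplittingLine_omega_center L e₁ dV₁ hdV₁ hdV₁0 θ hθu hθs a χ 𝔪 𝓕
  exact ⟨T, hT⟩

end Literature.NumberTheory.Automorphic.Liu2021.Def411WeilCarriers

end
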